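import Summits.CriticalPhenomena.PercolationContinuityZ3.Theorems.PercNearOneGluingNoHeavyQuantFarSunLawDefs
import Mathlib.Data.Nat.Choose.Sum
import HarnessLib

/-!
# FAR beyond trees: the CLOSED-FORM TWO-COPY CERTIFICATE `T_K` for `HairyCycle.SunFAR K 1` (every `K ≥ 4`) — definitions

builds on p205010 (kernel theorem, internal audit signed; external expert review pending)

Support file (`--supports stmt-CriticalPhenomena-4575`), seat `prim-cert-1` (gen 23); QUANT lane rung R8, front "FAR beyond trees".
Memo `prim-cert-1/FROM-prim-cert-1-g23-SUNFAR-ALL-K.md` (the all-`K` proof this vocabulary formalises; certificate found by gen 21,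
`FROM-prim-cert-1-g21-SUN-CERT-TK.md`).  DEFINITIONS ONLY (reviewed); the theorems are in `…QuantFarSunTK*`.

Conventions: hair INDICES `k < K` (index `k` = cycle position `k+1`); the two END indices are `0` and `K − 1` (the relays adjacent to the
observer), the INTERIOR ones `0 < k < K − 1` (`TK.inner K`); reached sets `R, R' : Finset ℕ` (subsets of `range K`).

* The certificate (gen 21 §1, units `b = 1`): `TK.aCoef K k R'` (the ghost copy's bet on relay `k`), `TK.bCoef K R'` (`= 1` iff `R'` is an
  interior singleton), the pair function `TK.Fcert K R R' = Σ_k a_k(R')(𝟙[k∉R] − 𝟙[|R|≤1]) − b(R')(|R|−2)` and its symmetrisation `TK.Wcert`.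
* Its COUNT-LEVEL form `TK.Fc` / `TK.Wc`: `Fcert K R R'` depends only on `|R ∩ inner|`, `|R' ∩ inner|`, `|R ∩ R' ∩ inner|` and the four end
  memberships (`…QuantFarSunTKStats`); `TK.ESt` = the five states of an end position in a law orbit (never reached / sure in both copies /
  sure in copy A only / sure in copy B only / split), `TK.endTerms` its (A-flag, B-flag) contributions, and `TK.Gc K c p q s e₀ e_K` = the
  count-level ORBIT SUM `Σ_j C(s,j) Σ_{end owners} Wc` (`c, p, q` = common / A-private / B-private interior sure relays, `s` interior splits).
* `TK.orbit K P_A P_B T = Σ_{J ⊆ T} Wcert K (P_A ∪ J) (P_B ∪ (T ∖ J))` — the set-level orbit sum (split hairs `T`, forced sets `P_A`, `P_B`).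
* The four count-level facts of memo §4 — (P1) level-2 positivity, (P2a/b/c) the `s ≤ 1` cases of the nested / separated-swap /
  overlapping-swap families — are THEOREMS about `TK.Gc` for every `K ≥ 4` (`…QuantFarSunTKCount*`); no `Prop` is posited here.
* Two-chain weights `TK.aL K g l` (`l ≤ K+1`: law of the first closed edge, `K+1` = none) and `TK.bM K g l'` (`l' ≤ K`: law of the last closed
  edge, `0` absorbing "none"), the general hair weight `TK.hw S h Q = ∏_{k∈S} (h k | 1 − h k)`, the one-copy two-chain expectation `TK.tcE` and the
  two-copy one `TK.tcE2` (`sunLaw K g h Φ = tcE K g h 𝟙[Φ]`, `…QuantFarSunTKTwoChain`).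
[cite: KozmaNitzan2024, Conjecture 3 (p. 15)] (the gluing rows FAR serves); [cite: Grimmett1999, §2.2] (product measure); objects [this work].
-/

noncomputable section

namespace Summit.CriticalPhenomena.PercolationContinuityZ3.Theorems.HairyCycle

open Finset

namespace TK

/-! ## Ends and interior (hair indices) -/

/-- The interior hair indices `0 < k < K − 1` (cycle positions `2 … K−1`). [this work] -/
def inner (K : ℕ) : Finset ℕ := (range K).filter fun k => k ≠ 0 ∧ k ≠ K - 1

/-! ## The certificate `T_K` (gen 21), set level, integer valued -/

open scoped Classical in
/-- `a_k(R')`: for an END index `k ∈ {0, K−1}`: `K − 2` if (`|R'| = 1` and `k ∉ R'`) or (`|R'| = 2` and `k ∈ R'`), else `0`;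
for an INTERIOR index: `2` if `R' = ∅`, `1` if `|R'| = 1`, `K − |R'|` if `|R'| ≥ 2` and `k ∈ R'`, else `0`. [this work] -/
def aCoef (K : ℕ) (k : ℕ) (R' : Finset ℕ) : ℤ :=
  if k = 0 ∨ k = K - 1 then
    (if (R'.card = 1 ∧ k ∉ R') ∨ (R'.card = 2 ∧ k ∈ R') then (K : ℤ) - 2 else 0)
  else
    (if R'.card = 0 then 2 else if R'.card = 1 then 1 else if k ∈ R' then (K : ℤ) - R'.card else 0)

open scoped Classical in
/-- `b(R') = 1` iff `R'` is a singleton `{v}` with `v` interior (`v ≠ 0`, `v ≠ K − 1`), else `0`. [this work] -/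
def bCoef (K : ℕ) (R' : Finset ℕ) : ℤ :=
  if R'.card = 1 ∧ (∀ v ∈ R', v ≠ 0 ∧ v ≠ K - 1) then 1 else 0

open scoped Classical in
/-- The pair function `F(R;R') = Σ_{k<K} a_k(R')·(𝟙[k ∉ R] − 𝟙[|R| ≤ 1]) − b(R')·(|R| − 2)` (copy `R`, ghost `R'`). [this work] -/
def Fcert (K : ℕ) (R R' : Finset ℕ) : ℤ :=
  (∑ k ∈ range K, aCoef K k R' * ((if k ∉ R then 1 else 0) - (if R.card ≤ 1 then 1 else 0))) -
    bCoef K R' * ((R.card : ℤ) - 2)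

/-- The symmetrised pair weight `W(R,R') = F(R;R') + F(R';R)`. [this work] -/
def Wcert (K : ℕ) (R R' : Finset ℕ) : ℤ := Fcert K R R' + Fcert K R' R

open scoped Classical in
/-- The set-level ORBIT SUM: split hairs `T` distributed over the two copies in all ways, forced hair sets `P_A`, `P_B`:
`orbit K P_A P_B T = Σ_{J ⊆ T} W(P_A ∪ J, P_B ∪ (T ∖ J))`. [this work] -/
def orbit (K : ℕ) (PA PB T : Finset ℕ) : ℤ := ∑ J ∈ T.powerset, Wcert K (PA ∪ J) (PB ∪ (T \ J))

/-! ## Count level -/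

/-- COUNT-LEVEL `F(V;U)` (copy `V`, ghost `U`): `vI`, `uI` = interior counts, `iI` = common interior count, `v0/vK/u0/uK` = membership of the
end indices `0` / `K−1` in `V` / `U`.  Case split on `|U| ∈ {0, 1, 2, ≥ 3}` (sizes computed in `ℕ`) exactly as `aCoef`/`bCoef`
(`…QuantFarSunTKStats` proves `Fcert K V U = Fc K …(statistics of V, U)`). [this work] -/
def Fc (K : ℕ) (vI uI iI : ℕ) (v0 vK u0 uK : Bool) : ℤ :=
  let v : ℕ := vI + v0.toNat + vK.toNat
  let u : ℕ := uI + u0.toNat + uK.toNat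
  let vE : ℤ := (v0.toNat : ℤ) + vK.toNat
  let uE : ℕ := u0.toNat + uK.toNat
  let iE : ℤ := ((v0 && u0).toNat : ℤ) + (vK && uK).toNat
  let low : ℤ := if v = 0 ∨ v = 1 then 1 else 0
  if u = 0 then 2 * ((K : ℤ) - 2 - vI) - 2 * ((K : ℤ) - 2) * low
  else if u = 1 then
    (if uE = 1 then ((K : ℤ) - 2 - vI) + ((K : ℤ) - 2) * (2 - vE - (1 - iE)) - ((K : ℤ) - 2) * 2 * low
     else ((K : ℤ) - 2 - vI) + ((K : ℤ) - 2) * (2 - vE) - ((K : ℤ) - 2) * 3 * low - ((v : ℤ) - 2))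
  else if u = 2 then ((K : ℤ) - 2) * (2 - iI - iE) - 2 * ((K : ℤ) - 2) * low
  else ((K : ℤ) - u) * ((uI : ℤ) - iI) - ((K : ℤ) - u) * uI * low

/-- COUNT-LEVEL symmetrised weight `W = F(V;U) + F(U;V)`. [this work] -/
def Wc (K : ℕ) (vI uI iI : ℕ) (v0 vK u0 uK : Bool) : ℤ :=
  Fc K vI uI iI v0 vK u0 uK + Fc K uI vI iI u0 uK v0 vK

/-- The five states of an END position in a (reduced) law orbit: `n` never reached, `c` sure relay in both copies, `p` sure relay of copy A only,
`q` sure relay of copy B only, `s` split (goes to exactly one copy, both ways summed). [this work] -/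
inductive ESt
  | n | c | p | q | s
  deriving DecidableEq, Repr

/-- The (in-copy-A, in-copy-B) flag pairs an end state contributes to an orbit sum (`s` contributes both owners). [this work] -/
def endTerms : ESt → List (Bool × Bool)
  | ESt.n => [(false, false)]
  | ESt.c => [(true, true)]
  | ESt.p => [(true, false)]
  | ESt.q => [(false, true)]
  | ESt.s => [(true, false), (false, true)]

/-- The B-private end state becomes A-private (`q ↦ p`) under the suffix swap; other states unchanged. [this work] -/
def ESt.qToP : ESt → ESt
  | ESt.q => ESt.p
  | e => e

/-- The sum of `Wc` over the end-owner patterns of the two end states, at given interior data. [this work] -/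
def endSum (K : ℕ) (vI uI iI : ℕ) (e0 eK : ESt) : ℤ :=
  ((endTerms e0).map fun a => ((endTerms eK).map fun b => Wc K vI uI iI a.1 b.1 a.2 b.2).sum).sum

/-- COUNT-LEVEL ORBIT SUM `G(e; c,p,q; s) = Σ_{j ≤ s} C(s,j) · Σ_{end owners} Wc(c+p+j, c+q+(s−j), c, flags)`: `c` common, `p` A-private,
`q` B-private interior sure relays, `s` interior split hairs, end states `e0`, `eK`. [this work] -/
def Gc (K : ℕ) (c p q s : ℕ) (e0 eK : ESt) : ℤ :=
  ∑ j ∈ range (s + 1), (s.choose j : ℤ) * endSum K (c + p + j) (c + q + (s - j)) c e0 eK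

/-- Admissible end states on the prefix side of a nested / crossing pair: `n`, `c`, `s`, `p` (never B-private). [this work] -/
def ESt.isLeft : ESt → Bool
  | ESt.q => false
  | _ => true

/-- Admissible end states on the suffix side of a crossing pair: `n`, `c`, `s`, `q` (never A-private). [this work] -/
def ESt.isRight : ESt → Bool
  | ESt.p => false
  | _ => true

/-! ## Two-chain weights and expectations (law level, real) -/

/-- Law of the FIRST closed cycle edge in the independent two-chain form: `aL l = α_l − α_{l+1}` (`l ≤ K`), `aL (K+1) = α_{K+1}` (none closed;
then every position is covered clockwise). [this work] -/
def aL (K : ℕ) (g : ℕ → ℝ) (l : ℕ) : ℝ := if l ≤ K then arcA g l - arcA g (l + 1) else arcA g (K + 1)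

/-- Law of the LAST closed cycle edge: `bM l' = β_{l'+1} − β_{l'}` (`1 ≤ l' ≤ K`), and `bM 0 = β_1` (last closed edge `e_0` or none; then every
position is covered counter-clockwise). [this work] -/
def bM (K : ℕ) (g : ℕ → ℝ) (l' : ℕ) : ℝ := if l' = 0 then arcB K g 1 else arcB K g (l' + 1) - arcB K g l'

open scoped Classical in
/-- Hair weight over an arbitrary index set `S`: `hw S h Q = ∏_{k ∈ S} (h k if k ∈ Q else 1 − h k)` (`hw (range K) = hairW K`). [this work] -/
def hw (S : Finset ℕ) (h : ℕ → ℝ) (Q : Finset ℕ) : ℝ := ∏ k ∈ S, if k ∈ Q then h k else 1 - h k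

/-- ONE-COPY two-chain expectation of a real function of the reached set:
`tcE K g h f = Σ_{Q ⊆ range K} Σ_{l ≤ K+1} Σ_{l' ≤ K} hairW Q · aL l · bM l' · f (Q ∩ cov K l l')` (`sunLaw K g h Φ = tcE K g h 𝟙[Φ]`). [this work] -/
def tcE (K : ℕ) (g h : ℕ → ℝ) (f : Finset ℕ → ℝ) : ℝ :=
  ∑ Q ∈ (range K).powerset, ∑ l ∈ range (K + 2), ∑ l' ∈ range (K + 1),
    hairW K h Q * aL K g l * bM K g l' * f (Q ∩ cov K l l')

/-- TWO-COPY (independent copies) two-chain expectation of a real function of the two reached sets. [this work] -/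
def tcE2 (K : ℕ) (g h : ℕ → ℝ) (Fn : Finset ℕ → Finset ℕ → ℝ) : ℝ :=
  ∑ Q ∈ (range K).powerset, ∑ Q' ∈ (range K).powerset,
    ∑ l ∈ range (K + 2), ∑ l' ∈ range (K + 1), ∑ m ∈ range (K + 2), ∑ m' ∈ range (K + 1),
      hairW K h Q * hairW K h Q' * (aL K g l * bM K g l' * (aL K g m * bM K g m')) *
        Fn (Q ∩ cov K l l') (Q' ∩ cov K m m')

end TK

end Summit.CriticalPhenomena.PercolationContinuityZ3.Theorems.HairyCycle

end
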